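import Literature.Probability.RandomPlanarGeometry.HexSAWStripBridgeKernelResidue
import Literature.Analysis.Asymptotics.KaramataPowerSeries
import HarnessLib

/-!
# The EXACT Cesàro coefficient law of critical strip bridges: `(1/M) Σ_{m<M} d_{ab}(m) y_T^m → ρ u_a ℓ_b / y_T`

Topic `Literature/Probability/RandomPlanarGeometry` (continues `HexSAWStripBridgeKernelResidue.lean` — the rank-one residue
`(y_T − y) · D_{ab}(y) → ρ u_a ℓ_b` of the generating functions `D_{ab}(y) = HV.hKernel T a b y` of the standard horizontal
Duminil-Copin–Hammond bridges of the width-`T` honeycomb strip between levels `a` and `b`).  Tool: the Hardy–Littlewood–Karamata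
Tauberian theorem for power series with non-negative coefficients, index `1` — the tree's
`Literature.Analysis.Asymptotics.hardyLittlewood_powerSeries_iff` (W. Feller, *An Introduction to Probability Theory and its Applications*
II, XIII.5 Theorem 5).  Sources of the SETTING: H. Duminil-Copin, A. Hammond, CMP 324 (2013) §2.2; N. R. Beaton, M. Bousquet-Mélou, J. de Gier,
H. Duminil-Copin, A. J. Guttmann, CMP 326 (2014), arXiv:1109.0358v5, §3.2 Corollary 8 (the radius `y_T`).  None of them states the law
below; in print the strip series are rational and such asymptotics would come from Perron–Frobenius — not used here.

## What is proved (namespace `Literature.Probability.RandomPlanarGeometry.SAW.HV`; `y_T = stripYT T`)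

* §1 `hbCoeffN T N m a b` — the coefficient of `y^m` in `Dab T N a b y` (★ `Dab_eq_sum_hbCoeffN`: the truncated generating function is the
  polynomial `Σ_{m≤N} d^{(N)}_{ab}(m) y^m` with non-negative coefficients), monotone in `N` (`hbCoeffN_mono`) and bounded by `D_{ab}(1)`;
  ★ `hbCoeff T m a b = sup_N hbCoeffN` — the `x_c`-weighted number `d_{ab}(m)` of standard horizontal bridges of `S_T` from level `a` to
  level `b` with exactly `m` surface contacts off the start vertex (`tendsto_hbCoeffN`).
* §2 ★★ `hKernel_eq_tsum_hbCoeff`: `D_{ab}(y) = Σ_m d_{ab}(m) y^m` for `y ∈ [1, y_T)` (monotone convergence of the truncations;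
  `summable_hbCoeff_mul_pow`).
* §3 ★ `tendsto_one_sub_mul_tsum_of_residue` — the Abelian input `(1 − s) Σ_m d_{ab}(m) y_T^m s^m → ρ u_a ℓ_b / y_T` (`s ↑ 1`, substitution
  `y = s y_T` in the residue theorem); ★★★ `exists_tendsto_cesaro_hbCoeff` (`T ≥ 2`): with the positive `u`, `ℓ`, `ρ` of the residue
  theorem, for all levels `a, b`: `(1/M) Σ_{m<M} d_{ab}(m) y_T^m → ρ u_a ℓ_b / y_T` as `M → ∞` — THE EXACT CESÀRO COEFFICIENT LAW
  (the lane's two-sided linear laws `Σ_{m≤M} (·) y_T^m ≍ M` upgraded to an exact asymptotic, for the bridge kernel).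

Label: LANE THEOREM (own result of lane «pcv-sawmu», a-p2 g18, 2026-08-25).  NOT claimed: the pointwise limit `d_{ab}(m) y_T^m → ρ u_a ℓ_b/y_T`
(the coefficientwise renewal theorem — it needs aperiodicity; open in the lane), the corresponding law for the β-walk coefficients
`β_{T,m}` of `B_T(x_c; ·)` (only two-sided bounds are in the tree), `T = 1`, uniformity in `T`.
-/

noncomputable section

open Finset Filter Topology Matrix Literature.Probability.LatticeModels Literature.Probability.Percolation Literature.Analysis.Matrix

namespace Literature.Probability.RandomPlanarGeometry.SAW

namespace HV

variable {T : ℕ}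

/-! ### §1 The contact coefficients of the horizontal-bridge generating functions -/

/-- `d^{(N)}_{ab}(m) = Σ x_c^{|h|−1}` over the standard horizontal bridges `a → b` with at most `N + 1` vertices and exactly `m` surface
contacts off the start vertex: the coefficient of `y^m` in `Dab T N a b y`. [cite: DuminilCopinHammond2013, §2.2; BeatonBousquetMelouDeGierDuminilCopinGuttmann2014, §3.2 (the surface fugacity y counts contacts)] -/
def hbCoeffN (T N m : ℕ) (a b : ℤ) : ℝ :=
  ∑ l ∈ (HBab T N a b).filter (fun l => topCnt T l.tail = m), hexCriticalFugacity ^ (l.length - 1)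

/-- `d^{(N)}_{ab}(m) ≥ 0`. [cite: DuminilCopinHammond2013, §2.2; lane plumbing] -/
theorem hbCoeffN_nonneg (T N m : ℕ) (a b : ℤ) : 0 ≤ hbCoeffN T N m a b :=
  sum_nonneg fun _ _ => pow_nonneg hexCriticalFugacity_pos_lt_one.1.le _

/-- A standard horizontal bridge with at most `N + 1` vertices has at most `N` contacts off its start vertex (plumbing).
[cite: DuminilCopinHammond2013, §2.2; lane plumbing] -/
theorem topCnt_tail_le_of_mem_HBab {N : ℕ} {a b : ℤ} {l : List HV} (hl : l ∈ HBab T N a b) : topCnt T l.tail ≤ N := by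
  rw [HBab, mem_filter, mem_hBridgesN_iff] at hl
  have h1 : topCnt T l.tail ≤ l.tail.length := List.length_filter_le _ _
  have h2 : l.tail.length ≤ N := by rw [List.length_tail]; omega
  exact h1.trans h2

/-- ★ `Dab T N a b y = Σ_{m ≤ N} d^{(N)}_{ab}(m) · y^m` — the truncated generating function is a polynomial in `y` with the
non-negative coefficients `hbCoeffN`. [cite: BeatonBousquetMelouDeGierDuminilCopinGuttmann2014, §3.2 (B_{T,L}(x; y) polynomial in y); lane plumbing] -/
theorem Dab_eq_sum_hbCoeffN (T N : ℕ) (a b : ℤ) (y : ℝ) :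
    Dab T N a b y = ∑ m ∈ range (N + 1), hbCoeffN T N m a b * y ^ m := by
  classical
  rw [Dab]
  have hmaps : ∀ l ∈ HBab T N a b, topCnt T l.tail ∈ range (N + 1) := fun l hl =>
    mem_range.2 (Nat.lt_succ_of_le (topCnt_tail_le_of_mem_HBab hl))
  rw [← sum_fiberwise_of_maps_to hmaps]
  refine sum_congr rfl fun m _ => ?_
  rw [hbCoeffN, sum_mul]
  refine sum_congr rfl fun l hl => ?_
  rw [mem_filter] at hl
  rw [wD, hl.2]

/-- `hBridgesN` grows with the vertex bound (plumbing). [cite: DuminilCopinHammond2013, §2.2; lane plumbing] -/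
theorem HBab_mono {N N' : ℕ} (h : N ≤ N') (a b : ℤ) : HBab T N a b ⊆ HBab T N' a b := by
  intro l hl
  rw [HBab, mem_filter, mem_hBridgesN_iff] at hl ⊢
  obtain ⟨⟨hc, hnd, hlen, hh, hin, hB⟩, h2, ha, hb⟩ := hl
  exact ⟨⟨hc, hnd, by omega, hh, hin, hB⟩, h2, ha, hb⟩

/-- The coefficients grow with the vertex bound. [cite: DuminilCopinHammond2013, §2.2; lane plumbing] -/
theorem hbCoeffN_mono {N N' : ℕ} (h : N ≤ N') (m : ℕ) (a b : ℤ) : hbCoeffN T N m a b ≤ hbCoeffN T N' m a b := by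
  classical
  refine sum_le_sum_of_subset_of_nonneg (fun l hl => ?_) fun _ _ _ => pow_nonneg hexCriticalFugacity_pos_lt_one.1.le _
  rw [mem_filter] at hl ⊢
  exact ⟨HBab_mono h a b hl.1, hl.2⟩

/-- `d^{(N)}_{ab}(m) ≤ Dab T N a b 1 ≤ D_{ab}(1)`: the coefficients are bounded (the series converges at `y = 1 < y_T`).
[cite: BeatonBousquetMelouDeGierDuminilCopinGuttmann2014, Corollary 8 (y_T > 1); lane plumbing] -/
theorem hbCoeffN_le_hKernel_one (hT : 1 ≤ T) (N m : ℕ) (a b : Fin (2 * T)) :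
    hbCoeffN T N m (a : ℕ) (b : ℕ) ≤ hKernel T a b 1 := by
  have h1mem : (1 : ℝ) ∈ Set.Ico (1 : ℝ) (stripYT T) := ⟨le_rfl, one_lt_stripYT hT⟩
  have hle : hbCoeffN T N m (a : ℕ) (b : ℕ) ≤ Dab T N (a : ℕ) (b : ℕ) 1 := by
    rw [Dab_eq_sum_hbCoeffN]
    simp only [one_pow, mul_one]
    by_cases hm : m ∈ range (N + 1)
    · exact single_le_sum (f := fun m => hbCoeffN T N m (a : ℕ) (b : ℕ)) (fun i _ => hbCoeffN_nonneg T N i _ _) hm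
    · -- no bridge with `≤ N+1` vertices has `m > N` contacts: the coefficient vanishes
      have h0 : hbCoeffN T N m (a : ℕ) (b : ℕ) = 0 := by
        rw [hbCoeffN]
        refine sum_eq_zero fun l hl => ?_
        rw [mem_filter] at hl
        exact absurd (mem_range.2 (Nat.lt_succ_of_le (hl.2 ▸ topCnt_tail_le_of_mem_HBab hl.1))) hm
      rw [h0]
      exact sum_nonneg fun i _ => hbCoeffN_nonneg T N i _ _
  exact hle.trans (le_ciSup (bddAbove_Dab hT h1mem a b) N)

/-- ★ **The contact coefficients** `d_{ab}(m) = sup_N d^{(N)}_{ab}(m)`: the `x_c`-weighted number of standard horizontal bridges of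
`S_T` from level `a` to level `b` with exactly `m` surface contacts off the start vertex.
[cite: DuminilCopinHammond2013, §2.2; BeatonBousquetMelouDeGierDuminilCopinGuttmann2014, §3.2] -/
def hbCoeff (T m : ℕ) (a b : Fin (2 * T)) : ℝ := ⨆ N : ℕ, hbCoeffN T N m (a : ℕ) (b : ℕ)

/-- `BddAbove` of the truncated coefficients. [cite: DuminilCopinHammond2013, §2.2; lane plumbing] -/
theorem bddAbove_hbCoeffN (hT : 1 ≤ T) (m : ℕ) (a b : Fin (2 * T)) :
    BddAbove (Set.range fun N : ℕ => hbCoeffN T N m (a : ℕ) (b : ℕ)) :=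
  ⟨hKernel T a b 1, by rintro _ ⟨N, rfl⟩; exact hbCoeffN_le_hKernel_one hT N m a b⟩

/-- `d^{(N)}_{ab}(m) ≤ d_{ab}(m)`, `0 ≤ d_{ab}(m)`, and `d^{(N)}_{ab}(m) → d_{ab}(m)`. [cite: DuminilCopinHammond2013, §2.2; lane plumbing] -/
theorem hbCoeffN_le_hbCoeff (hT : 1 ≤ T) (N m : ℕ) (a b : Fin (2 * T)) : hbCoeffN T N m (a : ℕ) (b : ℕ) ≤ hbCoeff T m a b :=
  le_ciSup (bddAbove_hbCoeffN hT m a b) N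

/-- `0 ≤ d_{ab}(m)`. [cite: DuminilCopinHammond2013, §2.2; lane plumbing] -/
theorem hbCoeff_nonneg (hT : 1 ≤ T) (m : ℕ) (a b : Fin (2 * T)) : 0 ≤ hbCoeff T m a b :=
  (hbCoeffN_nonneg T 0 m _ _).trans (hbCoeffN_le_hbCoeff hT 0 m a b)

/-- `d^{(N)}_{ab}(m) → d_{ab}(m)` as `N → ∞` (monotone convergence). [cite: DuminilCopinHammond2013, §2.2; lane plumbing] -/
theorem tendsto_hbCoeffN (hT : 1 ≤ T) (m : ℕ) (a b : Fin (2 * T)) :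
    Tendsto (fun N => hbCoeffN T N m (a : ℕ) (b : ℕ)) atTop (𝓝 (hbCoeff T m a b)) :=
  tendsto_atTop_ciSup (fun _ _ h => hbCoeffN_mono h m _ _) (bddAbove_hbCoeffN hT m a b)

/-! ### §2 `D_{ab}(y) = Σ_m d_{ab}(m) y^m` on `[1, y_T)` -/

/-- Finite sums of the coefficient series stay below `D_{ab}(y)`. [cite: DuminilCopinHammond2013, §2.2; lane plumbing] -/
theorem sum_range_hbCoeff_mul_pow_le (hT : 1 ≤ T) {y : ℝ} (hy : y ∈ Set.Ico 1 (stripYT T)) (a b : Fin (2 * T)) (M : ℕ) :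
    ∑ m ∈ range M, hbCoeff T m a b * y ^ m ≤ hKernel T a b y := by
  have hy0 : 0 ≤ y := zero_le_one.trans hy.1
  have hlim : Tendsto (fun N => ∑ m ∈ range M, hbCoeffN T N m (a : ℕ) (b : ℕ) * y ^ m) atTop
      (𝓝 (∑ m ∈ range M, hbCoeff T m a b * y ^ m)) :=
    tendsto_finsetSum _ fun m _ => (tendsto_hbCoeffN hT m a b).mul_const _
  refine le_of_tendsto hlim ?_
  filter_upwards [eventually_ge_atTop M] with N hN
  calc ∑ m ∈ range M, hbCoeffN T N m (a : ℕ) (b : ℕ) * y ^ m ≤ ∑ m ∈ range (N + 1), hbCoeffN T N m (a : ℕ) (b : ℕ) * y ^ m :=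
        sum_le_sum_of_subset_of_nonneg (range_mono (by omega)) fun m _ _ => mul_nonneg (hbCoeffN_nonneg T N m _ _) (pow_nonneg hy0 _)
    _ = Dab T N (a : ℕ) (b : ℕ) y := (Dab_eq_sum_hbCoeffN T N _ _ y).symm
    _ ≤ hKernel T a b y := le_ciSup (bddAbove_Dab hT hy a b) N

/-- The coefficient series is summable on `[1, y_T)`. [cite: BeatonBousquetMelouDeGierDuminilCopinGuttmann2014, Corollary 8; lane plumbing] -/
theorem summable_hbCoeff_mul_pow (hT : 1 ≤ T) {y : ℝ} (hy : y ∈ Set.Ico 1 (stripYT T)) (a b : Fin (2 * T)) :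
    Summable fun m => hbCoeff T m a b * y ^ m :=
  summable_of_sum_range_le (fun m => mul_nonneg (hbCoeff_nonneg hT m a b) (pow_nonneg (zero_le_one.trans hy.1) _))
    (sum_range_hbCoeff_mul_pow_le hT hy a b)

/-- ★★ **`D_{ab}(y) = Σ_m d_{ab}(m) y^m` for `y ∈ [1, y_T)`** (monotone convergence of the truncations).
[cite: BeatonBousquetMelouDeGierDuminilCopinGuttmann2014, §3.2 and Corollary 8; DuminilCopinHammond2013, §2.2] -/
theorem hKernel_eq_tsum_hbCoeff (hT : 1 ≤ T) {y : ℝ} (hy : y ∈ Set.Ico 1 (stripYT T)) (a b : Fin (2 * T)) :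
    hKernel T a b y = ∑' m, hbCoeff T m a b * y ^ m := by
  have hy0 : 0 ≤ y := zero_le_one.trans hy.1
  have hsum := summable_hbCoeff_mul_pow hT hy a b
  refine le_antisymm (ciSup_le fun N => ?_) (hsum.tsum_le_of_sum_range_le (sum_range_hbCoeff_mul_pow_le hT hy a b))
  calc Dab T N (a : ℕ) (b : ℕ) y = ∑ m ∈ range (N + 1), hbCoeffN T N m (a : ℕ) (b : ℕ) * y ^ m := Dab_eq_sum_hbCoeffN T N _ _ y
    _ ≤ ∑ m ∈ range (N + 1), hbCoeff T m a b * y ^ m :=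
        sum_le_sum fun m _ => mul_le_mul_of_nonneg_right (hbCoeffN_le_hbCoeff hT N m a b) (pow_nonneg hy0 _)
    _ ≤ ∑' m, hbCoeff T m a b * y ^ m :=
        hsum.sum_le_tsum _ fun m _ => mul_nonneg (hbCoeff_nonneg hT m a b) (pow_nonneg hy0 _)

/-! ### §3 The Hardy–Littlewood step: the exact Cesàro law of the contact coefficients -/

/-- The rescaled coefficient series is summable on `[0, 1)` (comparison with `y = max 1 (s y_T) < y_T`).
[cite: BeatonBousquetMelouDeGierDuminilCopinGuttmann2014, Corollary 8 (radius y_T); lane plumbing] -/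
theorem summable_hbCoeff_mul_pow_stripYT_mul_pow (hT : 1 ≤ T) (a b : Fin (2 * T)) {s : ℝ} (hs0 : 0 ≤ s) (hs1 : s < 1) :
    Summable fun m => hbCoeff T m a b * stripYT T ^ m * s ^ m := by
  have hyT := one_lt_stripYT hT
  have hyT0 : 0 ≤ stripYT T := by linarith
  -- dominate by the series at `y := max 1 (s y_T) ∈ [1, y_T)`
  set y : ℝ := max 1 (s * stripYT T) with hydef
  have hy : y ∈ Set.Ico (1 : ℝ) (stripYT T) :=
    ⟨le_max_left _ _, max_lt hyT (by nlinarith)⟩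
  refine (summable_hbCoeff_mul_pow hT hy a b).of_nonneg_of_le
    (fun m => mul_nonneg (mul_nonneg (hbCoeff_nonneg hT m a b) (pow_nonneg hyT0 _)) (pow_nonneg hs0 _)) fun m => ?_
  rw [mul_assoc, ← mul_pow]
  exact mul_le_mul_of_nonneg_left (pow_le_pow_left₀ (mul_nonneg hyT0 hs0) (by rw [mul_comm]; exact le_max_right _ _) _)
    (hbCoeff_nonneg hT m a b)

/-- ★ The Abelian input in the Hardy–Littlewood normalisation: `(1 − s) · Σ_m d_{ab}(m) y_T^m s^m → ρ u_a ℓ_b / y_T` as `s ↑ 1`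
(substitute `y = s · y_T` in `exists_tendsto_hKernel_residue`). [cite: DuminilCopinHammond2013, §2.2; Seneta1973, Chapter 6; lane] -/
theorem tendsto_one_sub_mul_tsum_of_residue (hT : 1 ≤ T) (a b : Fin (2 * T)) {R : ℝ}
    (hD : Tendsto (fun y => (stripYT T - y) * hKernel T a b y) (𝓝[<] stripYT T) (𝓝 R)) :
    Tendsto (fun s : ℝ => (1 - s) ^ (1 : ℝ) * ∑' m, hbCoeff T m a b * stripYT T ^ m * s ^ m) (𝓝[<] 1) (𝓝 (R / stripYT T)) := by
  have hyT := one_lt_stripYT hT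
  have hyT0 : 0 < stripYT T := by linarith
  -- the substitution `y = s · y_T`
  have hsub : Tendsto (fun s : ℝ => s * stripYT T) (𝓝[<] 1) (𝓝[<] stripYT T) := by
    refine tendsto_nhdsWithin_of_tendsto_nhds_of_eventually_within _ ?_ ?_
    · have : Tendsto (fun s : ℝ => s * stripYT T) (𝓝 1) (𝓝 (1 * stripYT T)) := tendsto_id.mul_const _
      rw [one_mul] at this
      exact this.mono_left nhdsWithin_le_nhds
    · filter_upwards [self_mem_nhdsWithin] with s hs
      exact mul_lt_of_lt_one_left hyT0 hs
  have h1 := (hD.comp hsub).div_const (stripYT T)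
  -- eventually `s y_T ≥ 1`, where the series is `D_{ab}(s y_T)`
  have hev : ∀ᶠ s in 𝓝[<] (1 : ℝ), s * stripYT T ∈ Set.Ico (1 : ℝ) (stripYT T) := by
    have h' : ∀ᶠ s in 𝓝[<] (1 : ℝ), s ∈ Set.Ioo (stripYT T)⁻¹ 1 := Ioo_mem_nhdsLT ((inv_lt_one₀ hyT0).2 hyT)
    filter_upwards [h'] with s hs
    refine ⟨?_, mul_lt_of_lt_one_left hyT0 hs.2⟩
    have := mul_lt_mul_of_pos_right hs.1 hyT0
    rw [inv_mul_cancel₀ hyT0.ne'] at this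
    exact this.le
  refine Tendsto.congr' ?_ h1
  filter_upwards [hev] with s hs
  simp only [Function.comp, Real.rpow_one]
  rw [hKernel_eq_tsum_hbCoeff hT hs a b]
  have heq : ∀ m, hbCoeff T m a b * (s * stripYT T) ^ m = hbCoeff T m a b * stripYT T ^ m * s ^ m := fun m => by
    rw [mul_pow]; ring
  simp_rw [heq]
  field_simp

/-- ★★★ **THE EXACT CESÀRO COEFFICIENT LAW OF CRITICAL STRIP BRIDGES** (`T ≥ 2`): there are positive level vectors `u`, `ℓ` and `ρ > 0`
(those of `exists_tendsto_hKernel_residue`) such that for all levels `a, b`: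
`(1/M) · Σ_{m<M} d_{ab}(m) · y_T^m ⟶ ρ · u_a ℓ_b / y_T` as `M → ∞`, where `d_{ab}(m)` is the `x_c`-weighted number of standard
horizontal bridges of `S_T` from level `a` to level `b` with exactly `m` surface contacts.  (Hardy–Littlewood's Tauberian theorem,
index `1`, on the residue.)  The lane's two-sided linear laws `Σ_{m≤M} (·) y_T^m ≍ M` become an EXACT first-order asymptotic for the
bridge kernel. [cite: Feller1971, XIII.5 Theorem 5 (Hardy–Littlewood–Karamata Tauberian theorem for power series); DuminilCopinHammond2013, §2.2; BeatonBousquetMelouDeGierDuminilCopinGuttmann2014, Corollary 8; lane «pcv-sawmu», a-p2 g18 — own result] -/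
theorem exists_tendsto_cesaro_hbCoeff (hT : 2 ≤ T) :
    ∃ (u ℓ : Fin (2 * T) → ℝ) (ρ : ℝ), (∀ a, 0 < u a) ∧ (∀ b, 0 < ℓ b) ∧ 0 < ρ ∧
      ∀ a b, Tendsto (fun M : ℕ => (∑ m ∈ range M, hbCoeff T m a b * stripYT T ^ m) / (M : ℝ)) atTop
        (𝓝 (ρ * (u a * ℓ b) / stripYT T)) := by
  have hT1 : 1 ≤ T := by omega
  have hyT0 : 0 < stripYT T := by linarith [one_lt_stripYT hT1]
  obtain ⟨IT, u, ℓ, ρ, -, hu0, hℓ0, -, -, hρ, hD⟩ := exists_tendsto_hKernel_residue hT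
  refine ⟨u, ℓ, ρ, hu0, hℓ0, hρ, fun a b => ?_⟩
  have hC : 0 < ρ * (u a * ℓ b) / stripYT T := div_pos (mul_pos hρ (mul_pos (hu0 a) (hℓ0 b))) hyT0
  have hq : ∀ m, 0 ≤ hbCoeff T m a b * stripYT T ^ m := fun m => mul_nonneg (hbCoeff_nonneg hT1 m a b) (pow_nonneg hyT0.le _)
  have hHL := (Literature.Analysis.Asymptotics.hardyLittlewood_powerSeries_iff (q := fun m => hbCoeff T m a b * stripYT T ^ m) hq zero_le_one hC).1
    ⟨fun s hs0 hs1 => summable_hbCoeff_mul_pow_stripYT_mul_pow hT1 a b hs0 hs1, tendsto_one_sub_mul_tsum_of_residue hT1 a b (hD a b)⟩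
  simp only [Real.rpow_one] at hHL
  rw [show (1 : ℝ) + 1 = 2 by norm_num, Real.Gamma_two, div_one] at hHL
  exact hHL

end HV

end Literature.Probability.RandomPlanarGeometry.SAW
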